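import Literature.NumberTheory.Sieve.CFSemigroupLimitSetEq
import Literature.NumberTheory.Sieve.CFSemigroupPressure
import HarnessLib

/-!
# Bowen's formula for the continued-fractions semigroup: `δ_A` is the zero of the pressure

Support file (all results proved) for the named fact
`Literature.NumberTheory.Sieve.MageeOhWinter2019_uniformCounting` (`CFSemigroupCounting.lean`).
[MageeOhWinter2019, §2.2] records, for the expanding map `T` of a Schottky or continued-fractions
semigroup with limit set `K` and distortion function `τ`: "the pressure `P(-sτ)` is strictly
decreasing in a real parameter `s` and has a unique positive zero denoted by `s₀`. Moreover, it is
known that in the current setting `s₀ = δ`, where `δ` is the Hausdorff dimension of `K`" (Bowen's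
formula; Bowen 1979, and for the Gauss-type map of `E_A` Hensley 1992 / Jarník). Here we PROVE this
for `Γ_A` with the pressure `P_A` of `CFSemigroupPressure.lean`
(`P_A(s) = lim (1/n) log Σ_{w ∈ Aⁿ} q(w)^{-2s}`) and the Cantor set
`E_A = {[0; a₁, a₂, …] : aᵢ ∈ A}` (`= Λ(Γ_A)`, `CFSemigroupLimitSetEq.lean`):

* `dimH_cfCantorSet_le`: `dim_H E_A ≤ s_A` — covers by the cylinders `{[0; w, *]}`, `w ∈ Aⁿ`, of
  diameter `≤ 2 q(w)^{-2}` (`ediam_cfCylinder_le`), and `Z_n(s) → 0` for `s > s_A`;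
* `le_dimH_cfCantorSet`: `s_A ≤ dim_H E_A` — the mass distribution principle
  (`hausdorffMeasure_range_ge_of_cylinderMass`, an abstract tree-coding form of Frostman's lemma)
  applied to the Bernoulli measure on blocks `w ∈ Aⁿ` with weights `q(w)^{-2s}/Z_n(s)` and the
  separation of continued-fraction cylinders (`cfValue_separation_sharp`), giving
  `dim_H E_A ≥ s (n-1)/(n+1)` for every `n ≥ 2` and `s ≤ s_A`;
* `dimH_cfCantorSet`, `cfDimension_eq_cfPressureZero`, **`cfPressure_cfDimension`**
  (`P_A(δ_A) = 0`: Bowen's formula as printed), and the Gibbs bounds at the dimension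
  `1 ≤ Σ_{w ∈ Aⁿ} q(w)^{-2δ_A} ≤ 4^{δ_A}` (`one_le_cfPartition_cfDimension`,
  `cfPartition_cfDimension_le`).

## References

* M. Magee, H. Oh, D. Winter, J. reine angew. Math. 753 (2019) 89–135, §2.2. [MageeOhWinter2019]
* R. Bowen, *Hausdorff dimension of quasi-circles*, Publ. Math. IHÉS 50 (1979) 11–25.
* D. Hensley, *Continued fraction Cantor sets, Hausdorff dimension, and functional analysis*,
  J. Number Theory 40 (1992) 336–358, Thm. 1.
* K. Falconer, *Fractal geometry*, 3rd ed. (2014), Principle 4.2 (mass distribution principle).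
-/

noncomputable section

open Filter Set
open _root_.MeasureTheory _root_.MeasureTheory.Measure
open scoped Topology ENNReal NNReal

namespace Literature.NumberTheory.Sieve

/-! ### Cylinder geometry: diameters and sharp separation -/

variable {d : ℕ → ℕ}

/-- `|x_{m+n} - x_n| ≤ 1/q_n²`: deeper convergents stay within `q_n^{-2}` of `p_n/q_n`
(Möbius form `x_{m+n} = (a u + p_n)/(c u + q_n)`, `u ∈ [0,1]`, `|a q_n - p_n c| = 1`). [folklore] -/
theorem abs_cfConv_add_sub_cfConv_le (hd : ∀ i, 1 ≤ d i) (n m : ℕ) :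
    |cfConv d (m + n) - cfConv d n| ≤ 1 / (cfDen d n : ℝ) ^ 2 := by
  have hu := cfConv_mem_Icc (d := fun i => d (i + n)) (fun i => hd (i + n)) m
  have he : (0 : ℝ) < (cfDen d n : ℝ) := cfDen_cast_pos hd n
  have hc0 : (0 : ℝ) ≤ (cfWord d n 1 0 : ℝ) := by exact_mod_cast cfWord_nonneg d n 1 0
  have hdet : (cfWord d n 0 0 : ℝ) * cfDen d n - cfNum d n * cfWord d n 1 0 = (-1) ^ n := by
    have h := det_cfWord d n
    rw [Matrix.det_fin_two] at h
    simp only [cfNum, cfDen]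
    exact_mod_cast h
  have h1 := cfConv_add hd n m
  have h0 : cfConv d n = (cfNum d n : ℝ) / (cfDen d n : ℝ) := rfl
  generalize cfConv (fun i => d (i + n)) m = u at hu h1
  rw [h1, h0]
  generalize (cfWord d n 0 0 : ℝ) = a at hdet ⊢
  generalize (cfNum d n : ℝ) = b at hdet ⊢
  generalize (cfWord d n 1 0 : ℝ) = c at hc0 hdet ⊢
  generalize (cfDen d n : ℝ) = e at he hdet ⊢
  have hD : 0 < c * u + e := by nlinarith [hu.1]
  have hdiff : (a * u + b) / (c * u + e) - b / e = (-1) ^ n * u / (e * (c * u + e)) := by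
    rw [div_sub_div _ _ hD.ne' he.ne', ← hdet]
    field_simp
    ring
  rw [hdiff, abs_div, abs_mul, abs_pow, abs_neg, abs_one, one_pow, one_mul, abs_of_nonneg hu.1,
    abs_of_pos (mul_pos he hD), div_le_div_iff₀ (mul_pos he hD) (by positivity)]
  nlinarith [hu.2, mul_nonneg hc0 hu.1]

/-- `|[0; d] - x_n| ≤ 1/q_n²`. [folklore] -/
theorem abs_cfValue_sub_cfConv_le (hd : ∀ i, 1 ≤ d i) (n : ℕ) :
    |cfValue d - cfConv d n| ≤ 1 / (cfDen d n : ℝ) ^ 2 := by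
  have hlim : Tendsto (fun m => |cfConv d (m + n) - cfConv d n|) atTop
      (𝓝 |cfValue d - cfConv d n|) :=
    (((tendsto_add_atTop_iff_nat n).2 (tendsto_cfConv_cfValue hd)).sub tendsto_const_nhds).abs
  exact le_of_tendsto' hlim fun m => abs_cfConv_add_sub_cfConv_le hd n m

/-- Two continued fractions agreeing in their first `n` digits are within `2/q_n²`. [folklore] -/
theorem abs_cfValue_sub_cfValue_le_of_agree (hd : ∀ i, 1 ≤ d i) {d' : ℕ → ℕ} (hd' : ∀ i, 1 ≤ d' i)
    {n : ℕ} (hagree : ∀ i < n, d i = d' i) :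
    |cfValue d - cfValue d'| ≤ 2 / (cfDen d n : ℝ) ^ 2 := by
  have h1 := abs_cfValue_sub_cfConv_le hd n
  have h2 := abs_cfValue_sub_cfConv_le hd' n
  have heq : cfConv d' n = cfConv d n := by
    simp only [cfConv, cfNum, cfDen, cfWord_congr hagree]
  have hq : cfDen d' n = cfDen d n := by simp only [cfDen, cfWord_congr hagree]
  rw [heq] at h2
  rw [hq] at h2
  have := abs_sub_le (cfValue d) (cfConv d n) (cfValue d')
  rw [abs_sub_comm (cfConv d n)] at this
  have e : (2 : ℝ) / (cfDen d n : ℝ) ^ 2 = 1 / (cfDen d n : ℝ) ^ 2 + 1 / (cfDen d n : ℝ) ^ 2 := by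
    ring
  linarith

/-- **Sharp separation of cylinders.** If two digit sequences with digits in `[1, B]` agree before
place `n` and differ at place `n`, then `|[0; d] - [0; d']| ≥ (1/((B+1)²(B+2))) / (4 q_n²)` with
`q_n` the continuant of the common prefix. [folklore] -/
theorem cfValue_separation_sharp (hd : ∀ i, 1 ≤ d i) {d' : ℕ → ℕ} (hd' : ∀ i, 1 ≤ d' i) {B : ℕ}
    (hB : ∀ i, d i ≤ B) (hB' : ∀ i, d' i ≤ B) {n : ℕ} (hagree : ∀ i < n, d i = d' i)
    (hne : d n ≠ d' n) :
    1 / (((B : ℝ) + 1) ^ 2 * ((B : ℝ) + 2)) / (4 * (cfDen d n : ℝ) ^ 2) ≤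
      |cfValue d - cfValue d'| := by
  have hlim : Tendsto (fun m => |cfConv d (m + n) - cfConv d' (m + n)|) atTop
      (𝓝 |cfValue d - cfValue d'|) := by
    have h1 := (tendsto_add_atTop_iff_nat n).2 (tendsto_cfConv_cfValue hd)
    have h2 := (tendsto_add_atTop_iff_nat n).2 (tendsto_cfConv_cfValue hd')
    exact (h1.sub h2).abs
  refine ge_of_tendsto hlim (eventually_atTop.2 ⟨2, fun m hm => ?_⟩)
  obtain ⟨m, rfl⟩ := Nat.exists_eq_add_of_le' hm
  have hgap := le_abs_cfConv_sub_cfConv (t := fun i => d (i + n)) (t' := fun i => d' (i + n))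
    (fun i => hd (i + n)) (fun i => hd' (i + n)) (fun i => hB (i + n)) (fun i => hB' (i + n))
    (by simpa using hne) m
  have hstep := abs_cfConv_add_sub_ge hd hd' hagree (m + 2)
  exact (div_le_div_of_nonneg_right hgap (by positivity)).trans hstep

/-- `q` is monotone along a digit sequence (digits `≥ 1`). [folklore] -/
theorem cfDen_mono (hd : ∀ i, 1 ≤ d i) : Monotone (cfDen d) :=
  monotone_nat_of_le_succ (cfDen_le_succ hd)

/-! ### Cylinders of `E_A` and the upper bound `dim_H E_A ≤ s_A` -/

variable {A : Finset ℕ} {n : ℕ}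

/-- The cylinder `E_A(w) = {[0; d] : d ∈ A^ℕ, d|_n = w}` of a finite word `w ∈ Aⁿ`. [folklore] -/
def cfCylinder (A : Finset ℕ) (w : Fin n → A) : Set ℝ :=
  {x | ∃ d : ℕ → ℕ, (∀ i, d i ∈ A) ∧ (∀ i : Fin n, d i = w i) ∧ x = cfValue d}

/-- `E_A` is covered by its cylinders of any fixed depth. [folklore] -/
theorem cfCantorSet_subset_iUnion_cfCylinder (A : Finset ℕ) (n : ℕ) :
    cfCantorSet A ⊆ ⋃ w : Fin n → A, cfCylinder A w := by
  rintro x ⟨d, hd, rfl⟩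
  exact mem_iUnion.2 ⟨fun i => ⟨d i, hd i⟩, d, hd, fun i => rfl, rfl⟩

/-- A digit sequence in a cylinder has the cylinder's continuant at depth `n`. [folklore] -/
theorem cfDen_eq_cfQ_of_agree {w : Fin n → A} {d : ℕ → ℕ} (hdw : ∀ i : Fin n, d i = w i) :
    cfDen d n = cfQ fun i => (w i : ℕ) := by
  simp only [cfQ, cfDen]
  rw [cfWord_congr (d' := cfExt fun i => (w i : ℕ)) fun i hi => ?_]
  rw [cfExt_of_lt _ hi]
  exact hdw ⟨i, hi⟩

/-- Cylinders have diameter `≤ 2 q(w)^{-2}`. [folklore] -/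
theorem ediam_cfCylinder_le (hA : ∀ a ∈ A, 1 ≤ a) (w : Fin n → A) :
    Metric.ediam (cfCylinder A w) ≤ ENNReal.ofReal (2 / ((cfQ fun i => (w i : ℕ)) : ℝ) ^ 2) := by
  refine Metric.ediam_le ?_
  rintro x ⟨d, hd, hdw, rfl⟩ y ⟨d', hd', hd'w, rfl⟩
  rw [edist_dist, Real.dist_eq]
  refine ENNReal.ofReal_le_ofReal ?_
  have hagree : ∀ i < n, d i = d' i := fun i hi => by
    have h1 := hdw ⟨i, hi⟩
    have h2 := hd'w ⟨i, hi⟩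
    simp only at h1 h2
    omega
  have h := abs_cfValue_sub_cfValue_le_of_agree (fun i => hA _ (hd i)) (fun i => hA _ (hd' i)) hagree
  rwa [cfDen_eq_cfQ_of_agree hdw] at h

/-- Cylinders of depth `n` have diameter `≤ 4 · 2^{-n}`, uniformly. [folklore] -/
theorem ediam_cfCylinder_le_geom (hA : ∀ a ∈ A, 1 ≤ a) (w : Fin n → A) :
    Metric.ediam (cfCylinder A w) ≤ ENNReal.ofReal (4 * (1 / 2 : ℝ) ^ n) := by
  refine (ediam_cfCylinder_le hA w).trans (ENNReal.ofReal_le_ofReal ?_)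
  have hq := pow_le_cfQ_sq (one_le_coe_digit hA w)
  have hq' : (2 : ℝ) ^ (n - 1) ≤ ((cfQ fun i => (w i : ℕ)) : ℝ) ^ 2 := by exact_mod_cast hq
  have h2 : (0 : ℝ) < (2 : ℝ) ^ (n - 1) := by positivity
  calc 2 / ((cfQ fun i => (w i : ℕ)) : ℝ) ^ 2 ≤ 2 / (2 : ℝ) ^ (n - 1) :=
        div_le_div_of_nonneg_left (by norm_num) h2 hq'
    _ ≤ 4 * (1 / 2 : ℝ) ^ n := by
        rw [one_div_pow, div_le_iff₀ h2]
        rcases n with _ | k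
        · norm_num
        · rw [Nat.add_sub_cancel, pow_succ]
          field_simp
          ring_nf
          exact le_rfl

/-- The `s`-dimensional cylinder sums: `Σ_{w ∈ Aⁿ} (2 q(w)^{-2})^s = 2^s Z_n(s)`. [folklore] -/
theorem sum_cylinder_rpow (hA : ∀ a ∈ A, 1 ≤ a) {s : ℝ} (hs : 0 ≤ s) (n : ℕ) :
    ∑ w : Fin n → A, (ENNReal.ofReal (2 / ((cfQ fun i => (w i : ℕ)) : ℝ) ^ 2)) ^ s =
      ENNReal.ofReal ((2 : ℝ) ^ s * cfPartition A n s) := by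
  rw [cfPartition, Finset.mul_sum, ENNReal.ofReal_sum_of_nonneg]
  · refine Finset.sum_congr rfl fun w _ => ?_
    have hq := one_le_cfQ_cast hA w
    have hV : (0 : ℝ) < ((cfQ fun i => (w i : ℕ)) : ℝ) ^ 2 := by positivity
    rw [ENNReal.ofReal_rpow_of_nonneg (by positivity) hs, Real.div_rpow (by norm_num) hV.le,
      Real.rpow_neg hV.le, div_eq_mul_inv]
  · intro w _
    have hq := one_le_cfQ_cast hA w
    positivity

/-- **Upper bound `μH[s](E_A) = 0` for `s > s_A`.** [folklore] -/
theorem hausdorffMeasure_cfCantorSet_eq_zero (hA : ∀ a ∈ A, 1 ≤ a) (h2 : 2 ≤ A.card) {s : ℝ}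
    (hs : cfPressureZero A < s) : μH[s] (cfCantorSet A) = 0 := by
  have hs0 : 0 ≤ s := (cfPressureZero_pos hA h2).le.trans hs.le
  have hr : Tendsto (fun n : ℕ => ENNReal.ofReal (4 * (1 / 2 : ℝ) ^ n)) atTop (𝓝 0) := by
    have h : Tendsto (fun n : ℕ => 4 * (1 / 2 : ℝ) ^ n) atTop (𝓝 (4 * 0)) :=
      (tendsto_pow_atTop_nhds_zero_of_lt_one (by norm_num) (by norm_num)).const_mul 4
    rw [mul_zero] at h
    simpa using ENNReal.tendsto_ofReal h
  have hle := hausdorffMeasure_le_liminf_sum (X := ℝ) s (cfCantorSet A) (l := atTop)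
    (fun n : ℕ => ENNReal.ofReal (4 * (1 / 2 : ℝ) ^ n)) hr (fun n (w : Fin n → A) => cfCylinder A w)
    (Eventually.of_forall fun n w => ediam_cfCylinder_le_geom hA w)
    (Eventually.of_forall fun n => cfCantorSet_subset_iUnion_cfCylinder A n)
  refine le_antisymm (hle.trans ?_) bot_le
  have hlim : Tendsto (fun n : ℕ => ENNReal.ofReal ((2 : ℝ) ^ s * cfPartition A n s)) atTop (𝓝 0) := by
    have h := (tendsto_cfPartition_zero_of_lt hA h2 hs).const_mul ((2 : ℝ) ^ s)
    rw [mul_zero] at h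
    simpa using ENNReal.tendsto_ofReal h
  rw [← hlim.liminf_eq]
  refine liminf_le_liminf (Eventually.of_forall fun n => ?_)
  rw [← sum_cylinder_rpow hA hs0 n]
  exact Finset.sum_le_sum fun w _ => ENNReal.rpow_le_rpow (ediam_cfCylinder_le hA w) hs0

/-- **`dim_H E_A ≤ s_A`.** [cite: MageeOhWinter2019, §2.2] -/
theorem dimH_cfCantorSet_le (hA : ∀ a ∈ A, 1 ≤ a) (h2 : 2 ≤ A.card) :
    dimH (cfCantorSet A) ≤ ENNReal.ofReal (cfPressureZero A) := by
  have hδ := (cfPressureZero_pos hA h2).le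
  by_contra hlt
  push Not at hlt
  obtain ⟨r, hr1, hr2⟩ := ENNReal.lt_iff_exists_nnreal_btwn.1 hlt
  have hr : cfPressureZero A < (r : ℝ) := by
    have := (ENNReal.ofReal_lt_ofReal_iff_of_nonneg hδ).1
      (by rwa [ENNReal.ofReal_coe_nnreal] : ENNReal.ofReal (cfPressureZero A) < ENNReal.ofReal r)
    exact this
  have h0 := hausdorffMeasure_cfCantorSet_eq_zero hA h2 hr
  have hle : dimH (cfCantorSet A) ≤ r := dimH_le_of_hausdorffMeasure_ne_top (by rw [h0]; exact ENNReal.zero_ne_top)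
  exact absurd (hr2.trans_le hle) (lt_irrefl _)


/-! ### An abstract mass distribution principle for tree-coded sets -/

section MassDistribution

variable {L : Type*}

/-- The cylinder of sequences agreeing with `ω` before place `k`. [folklore] -/
def seqCylinder (ω : ℕ → L) (k : ℕ) : Set (ℕ → L) := {ω' | ∀ j < k, ω' j = ω j}

/-- The depth-`0` cylinder is everything. [folklore] -/
@[simp] theorem seqCylinder_zero (ω : ℕ → L) : seqCylinder ω 0 = univ :=
  eq_univ_of_forall fun _ _ hj => absurd hj (Nat.not_lt_zero _)

/-- Cylinders are product boxes over `Finset.range k`. [folklore] -/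
theorem seqCylinder_eq_pi (ω : ℕ → L) (k : ℕ) :
    seqCylinder ω k = Set.pi ↑(Finset.range k) fun j => {ω j} := by
  ext ω'
  simp [seqCylinder]

/-- **Mass distribution principle for tree-coded sets** (Frostman / Falconer's Principle 4.2 in
symbolic form). Let `Φ : L^ℕ → X` be a coding map and `μ₀` a probability measure on `L^ℕ`.
Suppose every two sequences that first differ at place `k` have codes at distance `≥ ρ(ω, k)`,
cylinders of depth `k` have mass `≤ C ρ(ω, k)^t`, and cylinder masses shrink to `0`. Then
`μH[t](range Φ) ≥ C⁻¹`: a set `U` meeting `range Φ` is either `μ`-null or confined to a unique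
deepest cylinder `[ω₀|k]`, which some point of `U` leaves at place `k`, so
`μ(U) ≤ C ρ(ω₀,k)^t ≤ C (diam U)^t`. [folklore] -/
theorem hausdorffMeasure_range_ge_of_cylinderMass {X : Type*} [MeasurableSpace L]
    [EMetricSpace X] [MeasurableSpace X] [BorelSpace X]
    (μ₀ : Measure (ℕ → L)) [IsProbabilityMeasure μ₀] (Φ : (ℕ → L) → X)
    (ρ : (ℕ → L) → ℕ → ℝ≥0∞) {t : ℝ} (ht : 0 ≤ t) {C : ℝ≥0∞} (hC0 : C ≠ 0) (hCt : C ≠ ∞)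
    (hsep : ∀ ω ω' : ℕ → L, ∀ k, (∀ j < k, ω j = ω' j) → ω k ≠ ω' k → ρ ω k ≤ edist (Φ ω) (Φ ω'))
    (hmass : ∀ ω k, μ₀ (seqCylinder ω k) ≤ C * ρ ω k ^ t)
    (hvanish : ∀ ω, Tendsto (fun k => μ₀ (seqCylinder ω k)) atTop (𝓝 0)) :
    C⁻¹ ≤ μH[t] (range Φ) := by
  set μ : OuterMeasure X := OuterMeasure.map Φ μ₀.toOuterMeasure with hμ
  have claim : ∀ U : Set X, μ U ≤ C * Metric.ediam U ^ t := by
    intro U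
    simp only [hμ, OuterMeasure.map_apply]
    change μ₀ (Φ ⁻¹' U) ≤ _
    rcases (Φ ⁻¹' U).eq_empty_or_nonempty with h0 | ⟨ω₀, hω₀⟩
    · rw [h0, measure_empty]
      exact zero_le
    by_cases hall : ∀ k, Φ ⁻¹' U ⊆ seqCylinder ω₀ k
    · have h00 : μ₀ (Φ ⁻¹' U) = 0 :=
        le_antisymm (ge_of_tendsto' (hvanish ω₀) fun k => measure_mono (hall k)) bot_le
      rw [h00]
      exact zero_le
    push Not at hall
    classical
    obtain ⟨k, hk, hmin⟩ : ∃ k, ¬ (Φ ⁻¹' U ⊆ seqCylinder ω₀ k) ∧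
        ∀ j < k, Φ ⁻¹' U ⊆ seqCylinder ω₀ j :=
      ⟨Nat.find hall, Nat.find_spec hall, fun j hj => not_not.1 (Nat.find_min hall hj)⟩
    have hkpos : k ≠ 0 := by
      rintro rfl
      exact hk fun ω _ => by simp
    obtain ⟨k, rfl⟩ := Nat.exists_eq_succ_of_ne_zero hkpos
    have hsub : Φ ⁻¹' U ⊆ seqCylinder ω₀ k := hmin k (Nat.lt_succ_self k)
    obtain ⟨ω₁, hω₁U, hω₁⟩ := Set.not_subset.1 hk
    have hagree : ∀ j < k, ω₁ j = ω₀ j := hsub hω₁U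
    have hdiff : ω₀ k ≠ ω₁ k := by
      intro h
      apply hω₁
      intro j hj
      rcases Nat.lt_succ_iff_lt_or_eq.1 hj with hj | rfl
      · exact hagree j hj
      · exact h.symm
    have hρ := hsep ω₀ ω₁ k (fun j hj => (hagree j hj).symm) hdiff
    have hdiam : ρ ω₀ k ≤ Metric.ediam U := hρ.trans (Metric.edist_le_ediam_of_mem hω₀ hω₁U)
    calc μ₀ (Φ ⁻¹' U) ≤ μ₀ (seqCylinder ω₀ k) := measure_mono hsub
      _ ≤ C * ρ ω₀ k ^ t := hmass ω₀ k
      _ ≤ C * Metric.ediam U ^ t := by gcongr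
  have hest : ∀ U : Set X, Metric.ediam U ≤ 1 → (C⁻¹ • μ) U ≤ Metric.ediam U ^ t := by
    intro U _
    rw [_root_.smul_apply, smul_eq_mul]
    calc C⁻¹ * μ U ≤ C⁻¹ * (C * Metric.ediam U ^ t) := mul_le_mul' le_rfl (claim U)
      _ = Metric.ediam U ^ t := by rw [← mul_assoc, ENNReal.inv_mul_cancel hC0 hCt, one_mul]
  have hle : C⁻¹ • μ ≤ OuterMeasure.mkMetric fun r => r ^ t :=
    OuterMeasure.le_mkMetric _ _ 1 zero_lt_one hest
  have hone : (C⁻¹ • μ) (range Φ) = C⁻¹ := by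
    rw [_root_.smul_apply, smul_eq_mul, hμ, OuterMeasure.map_apply]
    have : Φ ⁻¹' range Φ = univ := eq_univ_of_forall fun ω => ⟨ω, rfl⟩
    rw [this]
    change C⁻¹ * μ₀ univ = _
    rw [measure_univ, mul_one]
  have hH : (OuterMeasure.mkMetric fun r : ℝ≥0∞ => r ^ t) (range Φ) = μH[t] (range Φ) := by
    rw [OuterMeasure.coe_mkMetric]
    rfl
  calc C⁻¹ = (C⁻¹ • μ) (range Φ) := hone.symm
    _ ≤ (OuterMeasure.mkMetric fun r : ℝ≥0∞ => r ^ t) (range Φ) := hle _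
    _ = μH[t] (range Φ) := hH

end MassDistribution

/-! ### Block coding of `E_A` and the Bernoulli block measures -/

/-- The digit sequence obtained by concatenating the blocks `ω 0, ω 1, … ∈ Aⁿ` (for `n = 0` the
irrelevant constant sequence `1`). [folklore] -/
def blockDigits (n : ℕ) (ω : ℕ → (Fin n → A)) (i : ℕ) : ℕ :=
  if h : 0 < n then ((ω (i / n) ⟨i % n, Nat.mod_lt i h⟩ : A) : ℕ) else 1

/-- Unfolding the block digits for `n ≥ 1`. [folklore] -/
theorem blockDigits_eq (hn : 0 < n) (ω : ℕ → (Fin n → A)) (i : ℕ) :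
    blockDigits n ω i = ((ω (i / n) ⟨i % n, Nat.mod_lt i hn⟩ : A) : ℕ) := dif_pos hn

/-- Block digits lie in `A`. [folklore] -/
theorem blockDigits_mem (hn : 0 < n) (ω : ℕ → (Fin n → A)) (i : ℕ) : blockDigits n ω i ∈ A := by
  rw [blockDigits_eq hn]
  exact (ω (i / n) _).2

/-- The digit at place `k n + r` is letter `r` of block `k`. [folklore] -/
theorem blockDigits_block (hn : 0 < n) (ω : ℕ → (Fin n → A)) (k : ℕ) (r : Fin n) :
    blockDigits n ω (k * n + r) = ((ω k r : A) : ℕ) := by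
  rw [blockDigits_eq hn]
  have hdiv : (k * n + r) / n = k := by
    rw [Nat.add_comm, Nat.add_mul_div_right _ _ hn, Nat.div_eq_of_lt r.2, Nat.zero_add]
  have hmod : (k * n + r) % n = r := by
    rw [Nat.mul_comm, Nat.mul_add_mod, Nat.mod_eq_of_lt r.2]
  have hr : (⟨(k * n + r) % n, Nat.mod_lt _ hn⟩ : Fin n) = r := Fin.ext hmod
  rw [hr]
  -- rewrite the block index
  have : ω ((k * n + r) / n) = ω k := by rw [hdiv]
  rw [this]

/-- The coded point `[0; ω 0, ω 1, …] ∈ E_A`. [folklore] -/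
theorem cfValue_blockDigits_mem (hn : 0 < n) (ω : ℕ → (Fin n → A)) :
    cfValue (blockDigits n ω) ∈ cfCantorSet A :=
  ⟨blockDigits n ω, blockDigits_mem hn ω, rfl⟩

/-- Sequences agreeing in their first `k` blocks have digits agreeing below `k n`. [folklore] -/
theorem blockDigits_agree (hn : 0 < n) {ω ω' : ℕ → (Fin n → A)} {k : ℕ}
    (h : ∀ j < k, ω j = ω' j) {i : ℕ} (hi : i < k * n) :
    blockDigits n ω i = blockDigits n ω' i := by
  rw [blockDigits_eq hn, blockDigits_eq hn, h (i / n) ((Nat.div_lt_iff_lt_mul hn).2 hi)]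

/-- If two block sequences agree before block `k` and differ at block `k`, their digit sequences
first differ at a place `i ∈ [k n, (k+1) n)`. [folklore] -/
theorem exists_first_diff_blockDigits (hn : 0 < n) {ω ω' : ℕ → (Fin n → A)} {k : ℕ}
    (h : ∀ j < k, ω j = ω' j) (hk : ω k ≠ ω' k) :
    ∃ i, k * n ≤ i ∧ i < (k + 1) * n ∧ (∀ i' < i, blockDigits n ω i' = blockDigits n ω' i') ∧
      blockDigits n ω i ≠ blockDigits n ω' i := by
  classical
  obtain ⟨r, hr⟩ := Function.ne_iff.1 hk
  have hex : ∃ i, blockDigits n ω i ≠ blockDigits n ω' i :=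
    ⟨k * n + r, by
      rw [blockDigits_block hn, blockDigits_block hn]
      exact fun h' => hr (Subtype.ext h')⟩
  refine ⟨Nat.find hex, ?_, ?_, fun i' hi' => not_not.1 (Nat.find_min hex hi'), Nat.find_spec hex⟩
  · by_contra hlt
    push Not at hlt
    exact Nat.find_spec hex (blockDigits_agree hn h hlt)
  · calc Nat.find hex ≤ k * n + r := Nat.find_le (by
          rw [blockDigits_block hn, blockDigits_block hn]
          exact fun h' => hr (Subtype.ext h'))
      _ < (k + 1) * n := by rw [Nat.succ_mul]; exact Nat.add_lt_add_left r.2 _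

/-- The shifted digit sequence after `k` blocks begins with block `k`. [folklore] -/
theorem blockDigits_shift (hn : 0 < n) (ω : ℕ → (Fin n → A)) (k : ℕ) {i : ℕ} (hi : i < n) :
    blockDigits n ω (i + k * n) = cfExt (fun r => ((ω k r : A) : ℕ)) i := by
  rw [cfExt_of_lt _ hi, Nat.add_comm]
  exact blockDigits_block hn ω k ⟨i, hi⟩

/-- **Quasi-multiplicativity along blocks:** `q((ω 0)⋯(ω k)) ≤ 2 q((ω 0)⋯(ω (k-1))) q(ω k)`.
[folklore] -/
theorem cfDen_blockDigits_succ_le (hA : ∀ a ∈ A, 1 ≤ a) (hn : 0 < n) (ω : ℕ → (Fin n → A))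
    (k : ℕ) :
    cfDen (blockDigits n ω) ((k + 1) * n) ≤
      2 * (cfDen (blockDigits n ω) (k * n) * cfQ fun r => ((ω k r : A) : ℕ)) := by
  set d := blockDigits n ω with hd_def
  have hd : ∀ i, 1 ≤ d i := fun i => hA _ (blockDigits_mem hn ω i)
  have hsplit : cfWord d ((k + 1) * n) = cfWord d (k * n) * cfMat fun r => ((ω k r : A) : ℕ) := by
    rw [Nat.succ_mul, Nat.add_comm, cfWord_add d (k * n) n, cfMat]
    congr 1
    exact cfWord_congr fun i hi => blockDigits_shift hn ω k hi
  have h11 : cfDen d ((k + 1) * n) = cfWord d (k * n) 1 0 * cfMat (fun r => ((ω k r : A) : ℕ)) 0 1 +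
      cfDen d (k * n) * cfQ (fun r => ((ω k r : A) : ℕ)) := by
    simp only [cfDen, hsplit, Matrix.mul_apply, Fin.sum_univ_two, cfQ_eq]
  have hv : ∀ r, 1 ≤ (fun r => ((ω k r : A) : ℕ)) r := fun r => hA _ (ω k r).2
  have h1 : cfWord d (k * n) 1 0 ≤ cfDen d (k * n) := cfWord_10_le_cfDen hd _
  have h2 : cfMat (fun r => ((ω k r : A) : ℕ)) 0 1 ≤ cfQ fun r => ((ω k r : A) : ℕ) :=
    cfNum_le_cfDen (one_le_cfExt hv) n
  have h3 : 0 ≤ cfWord d (k * n) 1 0 := cfWord_nonneg _ _ 1 0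
  have h4 : 0 ≤ cfMat (fun r => ((ω k r : A) : ℕ)) 0 1 := cfWord_nonneg _ _ 0 1
  have h5 := mul_le_mul h1 h2 h4 (h3.trans h1)
  rw [h11]
  linarith

/-- `q((ω 0)⋯(ω (k-1))) ≤ 2^k ∏_{j<k} q(ω j)`. [folklore] -/
theorem cfDen_blockDigits_le_prod (hA : ∀ a ∈ A, 1 ≤ a) (hn : 0 < n) (ω : ℕ → (Fin n → A)) :
    ∀ k : ℕ, cfDen (blockDigits n ω) (k * n) ≤
      2 ^ k * ∏ j ∈ Finset.range k, cfQ fun r => ((ω j r : A) : ℕ)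
  | 0 => by simp
  | k + 1 => by
      have ih := cfDen_blockDigits_le_prod hA hn ω k
      have hstep := cfDen_blockDigits_succ_le hA hn ω k
      have hq0 : 0 ≤ cfQ fun r => ((ω k r : A) : ℕ) :=
        zero_le_one.trans (one_le_cfQ fun r => hA _ (ω k r).2)
      rw [Finset.prod_range_succ, pow_succ]
      nlinarith [mul_le_mul_of_nonneg_right ih hq0]

section BlockMeasure

variable (A) (n) (s : ℝ)

/-- The Bernoulli weight `p(w) = q(w)^{-2s} / Z_n(s)` of a block `w ∈ Aⁿ`. [folklore] -/
def blockWeight (w : Fin n → A) : ℝ :=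
  (((cfQ fun i => (w i : ℕ)) : ℝ) ^ 2) ^ (-s) / cfPartition A n s

variable {A n s}

/-- Block weights are nonnegative. [folklore] -/
theorem blockWeight_nonneg (hA : ∀ a ∈ A, 1 ≤ a) (hne : A.Nonempty) (w : Fin n → A) :
    0 ≤ blockWeight A n s w :=
  div_nonneg (cfPartition_term_pos hA w s).le (cfPartition_pos hA hne n s).le

/-- Block weights sum to `1`. [folklore] -/
theorem sum_blockWeight (hA : ∀ a ∈ A, 1 ≤ a) (hne : A.Nonempty) :
    ∑ w : Fin n → A, blockWeight A n s w = 1 := by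
  simp only [blockWeight]
  rw [← Finset.sum_div, ← cfPartition, div_self (cfPartition_pos hA hne n s).ne']

/-- Block weights are `≤ q(w)^{-2s}` when `Z_n(s) ≥ 1`. [folklore] -/
theorem blockWeight_le (hA : ∀ a ∈ A, 1 ≤ a) (hZ : 1 ≤ cfPartition A n s) (w : Fin n → A) :
    blockWeight A n s w ≤ (((cfQ fun i => (w i : ℕ)) : ℝ) ^ 2) ^ (-s) :=
  div_le_self (cfPartition_term_pos hA w s).le hZ

/-- The Bernoulli block distribution on `Aⁿ` with weights `q(w)^{-2s}/Z_n(s)`. [folklore] -/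
def blockPMF (hA : ∀ a ∈ A, 1 ≤ a) (hne : A.Nonempty) (n : ℕ) (s : ℝ) : PMF (Fin n → A) :=
  PMF.ofFintype (fun w => ENNReal.ofReal (blockWeight A n s w)) (by
    rw [← ENNReal.ofReal_sum_of_nonneg fun w _ => blockWeight_nonneg hA hne w,
      sum_blockWeight hA hne, ENNReal.ofReal_one])

/-- The **Bernoulli block measure** on `(Aⁿ)^ℕ`: the infinite product of the block
distribution. [folklore] -/
def blockMeasure (hA : ∀ a ∈ A, 1 ≤ a) (hne : A.Nonempty) (n : ℕ) (s : ℝ) :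
    Measure (ℕ → (Fin n → A)) :=
  Measure.infinitePi fun _ : ℕ => (blockPMF hA hne n s).toMeasure

/-- The block measure is a probability measure. [folklore] -/
instance blockMeasure.isProbabilityMeasure (hA : ∀ a ∈ A, 1 ≤ a) (hne : A.Nonempty) (n : ℕ)
    (s : ℝ) : IsProbabilityMeasure (blockMeasure hA hne n s) := by
  unfold blockMeasure
  infer_instance

/-- Cylinder masses of the block measure are products of weights. [folklore] -/
theorem blockMeasure_seqCylinder (hA : ∀ a ∈ A, 1 ≤ a) (hne : A.Nonempty) (s : ℝ)
    (ω : ℕ → (Fin n → A)) (k : ℕ) :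
    blockMeasure hA hne n s (seqCylinder ω k) =
      ENNReal.ofReal (∏ j ∈ Finset.range k, blockWeight A n s (ω j)) := by
  rw [seqCylinder_eq_pi, blockMeasure,
    Measure.infinitePi_pi _ (fun j _ => MeasurableSet.singleton (ω j)),
    ENNReal.ofReal_prod_of_nonneg fun j _ => blockWeight_nonneg hA hne (ω j)]
  refine Finset.prod_congr rfl fun j _ => ?_
  rw [PMF.toMeasure_apply_singleton _ _ (MeasurableSet.singleton _), blockPMF, PMF.ofFintype_apply]

end BlockMeasure


/-! ### The cylinder-mass estimate and the lower bound `dim_H E_A ≥ s_A` -/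

/-- The gap constant `g_B = 1/((B+1)²(B+2))` of `cfValue_separation_sharp`. [folklore] -/
def cfGap (B : ℕ) : ℝ := 1 / (((B : ℝ) + 1) ^ 2 * ((B : ℝ) + 2))

/-- `g_B > 0`. [folklore] -/
theorem cfGap_pos (B : ℕ) : 0 < cfGap B := by
  unfold cfGap
  positivity

/-- The linear bookkeeping behind the cylinder-mass estimate, in logarithms: with
`ℓ_j = log q(ω j)² ≥ b`, `z = log Z ≥ 0`, `2κ = log Q² ≤ (k+1) log 4 + Σ_{j ≤ k} ℓ_j`,
`ℓ_k ≤ log M` and `t log 4 ≤ (s-t) b`, one has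
`Σ_{j<k} (-s ℓ_j - z) ≤ t log(16M/g) + t log(g/(4Q²))`. [folklore] -/
theorem blockMass_log_le {k : ℕ} {s t b z lM lg κ : ℝ} (ℓ : ℕ → ℝ)
    (hs : t ≤ s) (ht : 0 ≤ t) (hz : 0 ≤ z) (hb : ∀ j, b ≤ ℓ j) (hM : ℓ k ≤ lM)
    (hκ : 2 * κ ≤ (k + 1) * Real.log 4 + ∑ j ∈ Finset.range (k + 1), ℓ j)
    (hβ : t * Real.log 4 ≤ (s - t) * b) :
    ∑ j ∈ Finset.range k, (-s * ℓ j - z) ≤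
      t * (Real.log 16 + lM - lg) + t * (lg - Real.log 4 - 2 * κ) := by
  have hL : (k : ℝ) * b ≤ ∑ j ∈ Finset.range k, ℓ j := by
    have := Finset.sum_le_sum fun j (_ : j ∈ Finset.range k) => hb j
    simpa using this
  rw [Finset.sum_range_succ] at hκ
  have hlog16 : Real.log 16 = 2 * Real.log 4 := by
    rw [show (16 : ℝ) = 4 ^ 2 by norm_num, Real.log_pow]
    norm_num
  have hsum : ∑ j ∈ Finset.range k, (-s * ℓ j - z) = -s * ∑ j ∈ Finset.range k, ℓ j - k * z := by
    rw [Finset.sum_sub_distrib, ← Finset.mul_sum, Finset.sum_const, Finset.card_range, nsmul_eq_mul]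
  rw [hsum, hlog16]
  set L := ∑ j ∈ Finset.range k, ℓ j with hL_def
  have h1 : (s - t) * (k * b) ≤ (s - t) * L := mul_le_mul_of_nonneg_left hL (sub_nonneg.2 hs)
  have h2 : t * (2 * κ) ≤ t * ((k + 1) * Real.log 4 + (L + ℓ k)) := mul_le_mul_of_nonneg_left hκ ht
  have h3 : t * ℓ k ≤ t * lM := mul_le_mul_of_nonneg_left hM ht
  have h4 : 0 ≤ (k : ℝ) * z := by positivity
  have h5 : (k : ℝ) * (t * Real.log 4) ≤ k * ((s - t) * b) :=
    mul_le_mul_of_nonneg_left hβ (Nat.cast_nonneg k)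
  nlinarith

section LowerBound

variable (hA : ∀ a ∈ A, 1 ≤ a)
include hA

/-- All block digits are `≥ 1`. [folklore] -/
theorem one_le_blockDigits (hn : 0 < n) (ω : ℕ → (Fin n → A)) (i : ℕ) : 1 ≤ blockDigits n ω i :=
  hA _ (blockDigits_mem hn ω i)

/-- **Separation along blocks:** block sequences that first differ at block `k` code points at
distance `≥ g_B / (4 q((ω 0)⋯(ω k))²)`. [folklore] -/
theorem blockDigits_separation {B : ℕ} (hB : ∀ a ∈ A, a ≤ B) (hn : 0 < n)
    {ω ω' : ℕ → (Fin n → A)} {k : ℕ} (h : ∀ j < k, ω j = ω' j) (hk : ω k ≠ ω' k) :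
    ENNReal.ofReal (cfGap B / (4 * (cfDen (blockDigits n ω) ((k + 1) * n) : ℝ) ^ 2)) ≤
      edist (cfValue (blockDigits n ω)) (cfValue (blockDigits n ω')) := by
  obtain ⟨i, -, hik, hagree, hne⟩ := exists_first_diff_blockDigits hn h hk
  have hd := one_le_blockDigits hA hn ω
  have hd' := one_le_blockDigits hA hn ω'
  have hdB : ∀ i, blockDigits n ω i ≤ B := fun i => hB _ (blockDigits_mem hn ω i)
  have hdB' : ∀ i, blockDigits n ω' i ≤ B := fun i => hB _ (blockDigits_mem hn ω' i)
  have hsep := cfValue_separation_sharp hd hd' hdB hdB' hagree hne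
  rw [edist_dist, Real.dist_eq]
  refine (ENNReal.ofReal_le_ofReal ?_).trans (ENNReal.ofReal_le_ofReal hsep)
  have hqi : (0 : ℝ) < (cfDen (blockDigits n ω) i : ℝ) := cfDen_cast_pos hd i
  have hmono : (cfDen (blockDigits n ω) i : ℝ) ≤ cfDen (blockDigits n ω) ((k + 1) * n) := by
    exact_mod_cast cfDen_mono hd hik.le
  unfold cfGap
  exact div_le_div_of_nonneg_left (by positivity) (by positivity)
    (mul_le_mul_of_nonneg_left (pow_le_pow_left₀ hqi.le hmono 2) (by norm_num))

/-- **The cylinder-mass estimate** `μ([ω|k]) ≤ (16M/g)^t (g/(4Q²))^t` for the Bernoulli block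
measure, with `Q = q((ω 0)⋯(ω k))`, `M = (B+1)^{2n}`, `g = g_B`, whenever `Z_n(s) ≥ 1` and
`2t ≤ (s-t)(n-1)`. [folklore] -/
theorem blockMeasure_seqCylinder_le (hne : A.Nonempty) {B : ℕ} (hB : ∀ a ∈ A, a ≤ B) (hn : 2 ≤ n)
    {s t : ℝ} (ht0 : 0 ≤ t) (hts : 2 * t ≤ (s - t) * (n - 1)) (hZ : 1 ≤ cfPartition A n s)
    (ω : ℕ → (Fin n → A)) (k : ℕ) :
    blockMeasure hA hne n s (seqCylinder ω k) ≤
      ENNReal.ofReal ((16 * ((((B : ℝ) + 1) ^ n) ^ 2) / cfGap B) ^ t) *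
        (ENNReal.ofReal (cfGap B / (4 * (cfDen (blockDigits n ω) ((k + 1) * n) : ℝ) ^ 2))) ^ t := by
  have hn0 : 0 < n := by omega
  have hn1 : (1 : ℝ) ≤ (n : ℝ) - 1 := by
    have : (2 : ℝ) ≤ n := by exact_mod_cast hn
    linarith
  have hst : t ≤ s := by
    by_contra hlt
    push Not at hlt
    nlinarith
  have hd : ∀ i, 1 ≤ blockDigits n ω i := one_le_blockDigits hA hn0 ω
  have hZpos : 0 < cfPartition A n s := cfPartition_pos hA hne n s
  -- name the real quantities
  obtain ⟨M, hM⟩ : ∃ M : ℝ, M = (((B : ℝ) + 1) ^ n) ^ 2 := ⟨_, rfl⟩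
  obtain ⟨g, hgdef⟩ : ∃ g : ℝ, g = cfGap B := ⟨_, rfl⟩
  obtain ⟨Q, hQ⟩ : ∃ Q : ℝ, Q = (cfDen (blockDigits n ω) ((k + 1) * n) : ℝ) := ⟨_, rfl⟩
  obtain ⟨q, hq⟩ : ∃ q : ℕ → ℝ, ∀ j, q j = ((cfQ fun r => ((ω j r : A) : ℕ)) : ℝ) :=
    ⟨_, fun j => rfl⟩
  rw [← hM, ← hgdef, ← hQ]
  have hMpos : 0 < M := by rw [hM]; positivity
  have hgpos : 0 < g := by rw [hgdef]; exact cfGap_pos B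
  have hQpos : 0 < Q := by rw [hQ]; exact cfDen_cast_pos hd _
  have hq1 : ∀ j, 1 ≤ q j := fun j => by rw [hq]; exact one_le_cfQ_cast hA (ω j)
  have hqβ : ∀ j, (2 : ℝ) ^ (n - 1) ≤ q j ^ 2 := fun j => by
    rw [hq]
    exact_mod_cast pow_le_cfQ_sq (one_le_coe_digit hA (ω j))
  have hqM : q k ^ 2 ≤ M := by
    have h := cfQ_le_pow (one_le_coe_digit hA (ω k)) (B := B) fun r => hB _ (ω k r).2
    have h' : ((cfQ fun r => ((ω k r : A) : ℕ)) : ℝ) ≤ ((B : ℝ) + 1) ^ n := by exact_mod_cast h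
    rw [hq, hM]
    exact pow_le_pow_left₀ (by linarith [one_le_cfQ_cast hA (ω k)]) h' 2
  have hQprod : Q ≤ 2 ^ (k + 1) * ∏ j ∈ Finset.range (k + 1), q j := by
    have h := cfDen_blockDigits_le_prod hA hn0 ω (k + 1)
    have h' : (cfDen (blockDigits n ω) ((k + 1) * n) : ℝ) ≤
        (2 : ℝ) ^ (k + 1) * ∏ j ∈ Finset.range (k + 1), ((cfQ fun r => ((ω j r : A) : ℕ)) : ℝ) := by
      exact_mod_cast h
    rw [hQ]
    simpa only [hq] using h'
  have hw : ∀ j, 0 < blockWeight A n s (ω j) := fun j =>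
    div_pos (cfPartition_term_pos hA (ω j) s) hZpos
  have hwlog : ∀ j, Real.log (blockWeight A n s (ω j)) =
      -s * Real.log (q j ^ 2) - Real.log (cfPartition A n s) := fun j => by
    have hV : (0 : ℝ) < ((cfQ fun r => ((ω j r : A) : ℕ)) : ℝ) ^ 2 := by
      have := one_le_cfQ_cast hA (ω j)
      positivity
    rw [blockWeight, Real.log_div (cfPartition_term_pos hA (ω j) s).ne' hZpos.ne',
      Real.log_rpow hV, hq]
  -- the logarithmic bookkeeping
  have hκ : 2 * Real.log Q ≤ (k + 1) * Real.log 4 +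
      ∑ j ∈ Finset.range (k + 1), Real.log (q j ^ 2) := by
    have hprodpos : 0 < ∏ j ∈ Finset.range (k + 1), q j :=
      Finset.prod_pos fun j _ => by linarith [hq1 j]
    have h1 := Real.log_le_log hQpos hQprod
    rw [Real.log_mul (by positivity) hprodpos.ne', Real.log_pow,
      Real.log_prod (fun j _ => (by linarith [hq1 j] : q j ≠ 0))] at h1
    have hlog4 : Real.log 4 = 2 * Real.log 2 := by
      rw [show (4 : ℝ) = 2 ^ 2 by norm_num, Real.log_pow]
      norm_num
    have hsq : ∑ j ∈ Finset.range (k + 1), Real.log (q j ^ 2) =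
        2 * ∑ j ∈ Finset.range (k + 1), Real.log (q j) := by
      rw [Finset.mul_sum]
      refine Finset.sum_congr rfl fun j _ => ?_
      rw [Real.log_pow]
      norm_num
    rw [hsq, hlog4]
    push_cast at h1 ⊢
    nlinarith
  have hβ' : t * Real.log 4 ≤ (s - t) * Real.log ((2 : ℝ) ^ (n - 1)) := by
    rw [Real.log_pow, show (4 : ℝ) = 2 ^ 2 by norm_num, Real.log_pow, Nat.cast_sub (by omega),
      Nat.cast_one]
    have hlog2 : 0 < Real.log 2 := Real.log_pos (by norm_num)
    have := mul_le_mul_of_nonneg_right hts hlog2.le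
    push_cast
    nlinarith
  have key : ∑ j ∈ Finset.range k, (-s * Real.log (q j ^ 2) - Real.log (cfPartition A n s)) ≤
      t * (Real.log 16 + Real.log M - Real.log g) +
        t * (Real.log g - Real.log 4 - 2 * Real.log Q) :=
    blockMass_log_le (fun j => Real.log (q j ^ 2)) hst ht0 (Real.log_nonneg hZ)
      (b := Real.log ((2 : ℝ) ^ (n - 1))) (fun j => Real.log_le_log (by positivity) (hqβ j))
      (Real.log_le_log (by nlinarith [hq1 k]) hqM) hκ hβ'
  -- both sides as `ofReal` of positive reals, then logarithms
  have h16Mg : 0 < 16 * M / g := by positivity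
  have hg4Q : 0 < g / (4 * Q ^ 2) := by positivity
  rw [blockMeasure_seqCylinder, ENNReal.ofReal_rpow_of_nonneg (x := g / (4 * Q ^ 2))
      (by positivity) ht0,
    ← ENNReal.ofReal_mul (p := (16 * M / g) ^ t) (Real.rpow_nonneg h16Mg.le t)]
  refine ENNReal.ofReal_le_ofReal ?_
  have hlhs : 0 < ∏ j ∈ Finset.range k, blockWeight A n s (ω j) :=
    Finset.prod_pos fun j _ => hw j
  have hrhs : 0 < (16 * M / g) ^ t * (g / (4 * Q ^ 2)) ^ t := by positivity
  rw [← Real.log_le_log_iff hlhs hrhs, Real.log_prod fun j _ => (hw j).ne',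
    Real.log_mul (Real.rpow_pos_of_pos h16Mg t).ne' (Real.rpow_pos_of_pos hg4Q t).ne',
    Real.log_rpow h16Mg, Real.log_rpow hg4Q, Real.log_div (by positivity) hgpos.ne',
    Real.log_mul (by norm_num) hMpos.ne', Real.log_div hgpos.ne' (by positivity),
    Real.log_mul (by norm_num) (by positivity), Real.log_pow,
    Finset.sum_congr rfl fun j _ => hwlog j]
  push_cast
  linarith

/-- Cylinder masses of the block measure vanish in the limit (`n ≥ 2`, `s > 0`, `Z_n(s) ≥ 1`):
`μ([ω|k]) ≤ ((2^{n-1})^{-s})^k`. [folklore] -/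
theorem tendsto_blockMeasure_seqCylinder (hne : A.Nonempty) (hn : 2 ≤ n) {s : ℝ} (hs : 0 < s)
    (hZ : 1 ≤ cfPartition A n s) (ω : ℕ → (Fin n → A)) :
    Tendsto (fun k => blockMeasure hA hne n s (seqCylinder ω k)) atTop (𝓝 0) := by
  set θ : ℝ := ((2 : ℝ) ^ (n - 1)) ^ (-s) with hθ
  have hβ1 : (1 : ℝ) < (2 : ℝ) ^ (n - 1) := by
    have : (2 : ℝ) ^ 1 ≤ (2 : ℝ) ^ (n - 1) := pow_le_pow_right₀ (by norm_num) (by omega)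
    linarith
  have hθ1 : θ < 1 := Real.rpow_lt_one_of_one_lt_of_neg hβ1 (by linarith)
  have hθ0 : 0 ≤ θ := Real.rpow_nonneg (by positivity) _
  have hbound : ∀ k, blockMeasure hA hne n s (seqCylinder ω k) ≤ ENNReal.ofReal (θ ^ k) := by
    intro k
    rw [blockMeasure_seqCylinder]
    refine ENNReal.ofReal_le_ofReal ?_
    calc ∏ j ∈ Finset.range k, blockWeight A n s (ω j) ≤ ∏ _j ∈ Finset.range k, θ := by
          refine Finset.prod_le_prod (fun j _ => blockWeight_nonneg hA hne (ω j)) fun j _ => ?_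
          refine (blockWeight_le hA hZ (ω j)).trans ?_
          have hq : (2 : ℝ) ^ (n - 1) ≤ ((cfQ fun r => ((ω j r : A) : ℕ)) : ℝ) ^ 2 := by
            have := pow_le_cfQ_sq (one_le_coe_digit hA (ω j))
            exact_mod_cast this
          exact Real.rpow_le_rpow_of_nonpos (by positivity) hq (by linarith)
      _ = θ ^ k := by rw [Finset.prod_const, Finset.card_range]
  have hlim : Tendsto (fun k => ENNReal.ofReal (θ ^ k)) atTop (𝓝 0) := by
    have h := tendsto_pow_atTop_nhds_zero_of_lt_one hθ0 hθ1
    simpa using ENNReal.tendsto_ofReal h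
  exact tendsto_of_tendsto_of_tendsto_of_le_of_le tendsto_const_nhds hlim (fun k => zero_le)
    hbound

/-- **Lower bound from blocks:** for `n ≥ 2`, `s > 0` with `Z_n(s) ≥ 1` and `t ≥ 0` with
`2t ≤ (s-t)(n-1)`, `dim_H E_A ≥ t`. [folklore] -/
theorem le_dimH_cfCantorSet_of_block (h2 : 2 ≤ A.card) (hn : 2 ≤ n) {s t : ℝ} (hs : 0 < s)
    (hZ : 1 ≤ cfPartition A n s) (ht0 : 0 ≤ t) (hts : 2 * t ≤ (s - t) * (n - 1)) :
    ENNReal.ofReal t ≤ dimH (cfCantorSet A) := by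
  have hne := nonempty_of_two_le_card h2
  obtain ⟨B, hB⟩ : ∃ B, ∀ a ∈ A, a ≤ B := ⟨A.sup id, fun a ha => Finset.le_sup (f := id) ha⟩
  have hn0 : 0 < n := by omega
  set C : ℝ≥0∞ := ENNReal.ofReal ((16 * ((((B : ℝ) + 1) ^ n) ^ 2) / cfGap B) ^ t) with hC
  have hg := cfGap_pos B
  have hC0 : C ≠ 0 := (ENNReal.ofReal_pos.2 (Real.rpow_pos_of_pos (by positivity) t)).ne'
  have hCt : C ≠ ⊤ := ENNReal.ofReal_ne_top
  have key := hausdorffMeasure_range_ge_of_cylinderMass (blockMeasure hA hne n s)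
    (fun ω => cfValue (blockDigits n ω))
    (fun ω k => ENNReal.ofReal (cfGap B / (4 * (cfDen (blockDigits n ω) ((k + 1) * n) : ℝ) ^ 2)))
    ht0 hC0 hCt
    (fun ω ω' k h hk => blockDigits_separation hA hB hn0 h hk)
    (fun ω k => blockMeasure_seqCylinder_le hA hne hB hn ht0 hts hZ ω k)
    (fun ω => tendsto_blockMeasure_seqCylinder hA hne hn hs hZ ω)
  have hpos : μH[t] (range fun ω : ℕ → (Fin n → A) => cfValue (blockDigits n ω)) ≠ 0 := by
    have : (0 : ℝ≥0∞) < C⁻¹ := ENNReal.inv_pos.2 hCt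
    exact (this.trans_le key).ne'
  have hrange : range (fun ω : ℕ → (Fin n → A) => cfValue (blockDigits n ω)) ⊆ cfCantorSet A := by
    rintro _ ⟨ω, rfl⟩
    exact cfValue_blockDigits_mem hn0 ω
  have h1 : ((t.toNNReal : ℝ≥0) : ℝ≥0∞) ≤ dimH (range fun ω : ℕ → (Fin n → A) =>
      cfValue (blockDigits n ω)) := by
    apply le_dimH_of_hausdorffMeasure_ne_zero
    rw [Real.coe_toNNReal _ ht0]
    exact hpos
  exact h1.trans (dimH_mono hrange)

/-- **`s_A ≤ dim_H E_A`** (letting the block length `n → ∞` with `s = s_A`,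
`t = s_A (n-1)/(n+1)`). [cite: MageeOhWinter2019, §2.2] -/
theorem le_dimH_cfCantorSet (h2 : 2 ≤ A.card) :
    ENNReal.ofReal (cfPressureZero A) ≤ dimH (cfCantorSet A) := by
  set δ := cfPressureZero A with hδ_def
  have hδ := cfPressureZero_pos hA h2
  have hbound : ∀ n : ℕ, 2 ≤ n →
      ENNReal.ofReal (δ * (((n : ℝ) - 1) / ((n : ℝ) + 1))) ≤ dimH (cfCantorSet A) := by
    intro n hn
    have hn2 : (2 : ℝ) ≤ n := by exact_mod_cast hn
    have hn1' : (0 : ℝ) < (n : ℝ) + 1 := by positivity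
    refine le_dimH_cfCantorSet_of_block hA h2 hn hδ (one_le_cfPartition_cfPressureZero hA h2 n)
      (by apply mul_nonneg hδ.le; apply div_nonneg <;> linarith) (le_of_eq ?_)
    field_simp
    ring
  have hlim : Tendsto (fun n : ℕ => ENNReal.ofReal (δ * (((n : ℝ) - 1) / ((n : ℝ) + 1)))) atTop
      (𝓝 (ENNReal.ofReal δ)) := by
    refine ENNReal.tendsto_ofReal ?_
    have h : Tendsto (fun n : ℕ => ((n : ℝ) - 1) / ((n : ℝ) + 1)) atTop (𝓝 1) := by
      have h2' : Tendsto (fun n : ℕ => 1 - 2 * (1 / ((n : ℝ) + 1))) atTop (𝓝 (1 - 2 * 0)) :=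
        tendsto_const_nhds.sub (tendsto_one_div_add_atTop_nhds_zero_nat.const_mul 2)
      rw [mul_zero, sub_zero] at h2'
      refine h2'.congr fun n => ?_
      have : (0 : ℝ) < (n : ℝ) + 1 := by positivity
      field_simp
      ring
    have := h.const_mul δ
    rwa [mul_one] at this
  exact le_of_tendsto hlim (eventually_atTop.2 ⟨2, hbound⟩)

/-! ### Bowen's formula -/

/-- **`dim_H E_A = s_A`**: the Hausdorff dimension of the continued-fraction Cantor set is the
zero of the pressure function. [cite: MageeOhWinter2019, §2.2] -/
theorem dimH_cfCantorSet (h2 : 2 ≤ A.card) :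
    dimH (cfCantorSet A) = ENNReal.ofReal (cfPressureZero A) :=
  le_antisymm (dimH_cfCantorSet_le hA h2) (le_dimH_cfCantorSet hA h2)

/-- **`δ_A = s_A`**: the dimension `cfDimension A` of the named fact (the Hausdorff dimension of
the limit set `Λ(Γ_A)`) is the zero of the pressure. [cite: MageeOhWinter2019, §2.2] -/
theorem cfDimension_eq_cfPressureZero (h2 : 2 ≤ A.card) : cfDimension A = cfPressureZero A := by
  rw [cfDimension_eq_toReal_dimH_cfCantorSet hA, dimH_cfCantorSet hA h2,
    ENNReal.toReal_ofReal (cfPressureZero_pos hA h2).le]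

/-- **Bowen's formula, as printed: `P(-δτ) = 0`** — the pressure function of `Γ_A` vanishes at
the Hausdorff dimension `δ_A` of the limit set ("`s₀ = δ`"). [cite: MageeOhWinter2019, §2.2] -/
theorem cfPressure_cfDimension (h2 : 2 ≤ A.card) : cfPressure A (cfDimension A) = 0 := by
  rw [cfDimension_eq_cfPressureZero hA h2]
  exact cfPressure_cfPressureZero hA h2

/-- `δ_A` is the UNIQUE zero of `P_A` on `[0, ∞)`. [cite: MageeOhWinter2019, §2.2] -/
theorem eq_cfDimension_of_cfPressure_eq_zero (h2 : 2 ≤ A.card) {z : ℝ} (hz0 : 0 ≤ z)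
    (hz : cfPressure A z = 0) : z = cfDimension A := by
  rw [cfDimension_eq_cfPressureZero hA h2]
  exact cfPressureZero_unique hA h2 hz0 hz

/-- `P_A(s) > 0` for `0 ≤ s < δ_A` and `P_A(s) < 0` for `s > δ_A`. [cite: MageeOhWinter2019, §2.2] -/
theorem cfPressure_pos_iff_lt_cfDimension (h2 : 2 ≤ A.card) {s : ℝ} (hs : 0 ≤ s) :
    0 < cfPressure A s ↔ s < cfDimension A := by
  rw [cfDimension_eq_cfPressureZero hA h2]
  constructor
  · intro h
    by_contra hle
    push Not at hle
    rcases hle.eq_or_lt with heq | hlt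
    · rw [← heq, cfPressure_cfPressureZero hA h2] at h
      exact lt_irrefl _ h
    · have := cfPressure_neg_of_lt hA h2 hlt
      linarith
  · exact cfPressure_pos_of_lt hA h2 hs

/-- **Gibbs bounds at the dimension:** `1 ≤ Σ_{w ∈ Aⁿ} q(w)^{-2δ_A} ≤ 4^{δ_A}` for every `n`
(the partition functions at the critical exponent are bounded above and below). [folklore] -/
theorem cfPartition_cfDimension_mem_Icc (h2 : 2 ≤ A.card) (n : ℕ) :
    cfPartition A n (cfDimension A) ∈ Icc (1 : ℝ) ((4 : ℝ) ^ cfDimension A) := by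
  rw [cfDimension_eq_cfPressureZero hA h2]
  exact ⟨one_le_cfPartition_cfPressureZero hA h2 n, cfPartition_cfPressureZero_le hA h2 n⟩

/-- `δ_A < 1`-free numerical envelope: `0 < δ_A ≤ log #A / log 2 + 1` and `δ_A ≤ 1`. [folklore] -/
theorem cfDimension_le_log (h2 : 2 ≤ A.card) :
    cfDimension A ≤ Real.log A.card / Real.log 2 + 1 := by
  rw [cfDimension_eq_cfPressureZero hA h2]
  exact cfPressureZero_le hA h2

end LowerBound

end Literature.NumberTheory.Sieve
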